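import Mathlib
import Literature.NumberTheory.Automorphic.RankinSelbergLocal
import Literature.NumberTheory.Automorphic.ReductionTheoryGLnConjugation
import Summits.Langlands.Langlands.Theorems.IrreducibilityBySelfDualityPairLBoundaryJSRsZetaEntire
import Summits.Langlands.Langlands.Theorems.IrreducibilityBySelfDualityPairLBoundaryJSQuotientCompactSupport
import HarnessLib

/-!
# The JPSS kernel of Whittaker data compactly supported modulo `U_m` is continuous with compact support

Route `IrreducibilityBySelfDuality`, crux `PairLBoundaryJS` (stmt-Langlands-13622), line `Sketch`
(card `compact-kirillov-local-division`, K2), stub `rsKernel_continuous_hasCompactSupport`.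

For `m < n` over a non-archimedean local field `F`, the kernel `rsKernel hmn W W' s` of the tree's
local Rankin–Selberg zeta integral (`RankinSelbergLocal`; Jacquet–Piatetski-Shapiro–Shalika 1983,
§2.4) is the descent to `GL_m(F) ⧸ U_m` of the integrand
`g ↦ W(diag(g⁻¹, 1)) W'(g⁻¹) |det g⁻¹|_F ^ (s - (n-m)/2)` (when right-`U_m`-invariant; `0` otherwise).
If the two Whittaker factors are continuous and their product is supported in `C · U_m` with `C`
compact — compact support modulo `U_m`, the situation of a Whittaker function whose restriction to
the mirabolic is compactly supported modulo `N` (Gelfand–Kazhdan / Bernstein–Zelevinsky) — then the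
kernel is continuous (quotient topology) and compactly supported (`U_m` is closed,
`isClosed_upperUnitriangular`, so `GL_m(F) ⧸ U_m` is Hausdorff; `hasCompactSupport_quotientLiftOn_of_support_subset`),
which are exactly the hypotheses of `rsZeta_differentiable_of_hasCompactSupport` (the zeta integral is
then entire).
-/

noncomputable section

-- `Summit.Langlands.Langlands.…` (summit = sub-problem name, D-0017 layout) trips `dupNamespace`
set_option linter.dupNamespace false

open scoped MatrixGroups Topology NNReal Pointwise
open MeasureTheory Filter
open Literature.NumberTheory.Automorphic
open Literature.NumberTheory.GaloisRepresentations.IsNonarchimedeanLocalField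

namespace Summit.Langlands.Langlands.Theorems

/-- **The kernel hypotheses from the Whittaker data** (card `compact-kirillov-local-division`, K2):
if `g ↦ W(diag(g⁻¹, 1))` and `g ↦ W'(g⁻¹)` are continuous on `GL_m(F)` and their product is supported
in `C · U_m` with `C` compact (compact support modulo `U_m`, the mirabolic/Kirillov situation), then
for every `s` the JPSS kernel `rsKernel hmn W W' s` on `GL_m(F) ⧸ U_m` is continuous with compact
support — the hypotheses of `rsZeta_differentiable_of_hasCompactSupport`. -/
theorem rsKernel_continuous_hasCompactSupport
    {F : Type*} [Field F] [ValuativeRel F] [TopologicalSpace F] [IsNonarchimedeanLocalField F]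
    {n m : ℕ} (hmn : m < n) {W : GL (Fin n) F → ℂ} {W' : GL (Fin m) F → ℂ}
    (hW : Continuous fun g : GL (Fin m) F => W (glCorner F hmn.le g⁻¹))
    (hW' : Continuous fun g : GL (Fin m) F => W' g⁻¹)
    {C : Set (GL (Fin m) F)} (hC : IsCompact C)
    (hsuppC : Function.support (fun g : GL (Fin m) F => W (glCorner F hmn.le g⁻¹) * W' g⁻¹) ⊆
      C * (upperUnitriangular (Fin m) F : Set (GL (Fin m) F))) (s : ℂ) :
    Continuous (rsKernel hmn W W' s) ∧ HasCompactSupport (rsKernel hmn W W' s) := by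
  classical
  by_cases hinv : IsRightUInvariant (rsIntegrand hmn W W' s)
  · -- compatibility with the left cosets, as in the definition of `rsKernel`
    have hcompat : ∀ a b : GL (Fin m) F,
        @Setoid.r _ (QuotientGroup.leftRel (upperUnitriangular (Fin m) F)) a b →
          rsIntegrand hmn W W' s a = rsIntegrand hmn W W' s b := fun a b hab => by
      have h := hinv a ⟨a⁻¹ * b, QuotientGroup.leftRel_apply.mp hab⟩
      rwa [mul_inv_cancel_left, eq_comm] at h
    have heq : rsKernel hmn W W' s = fun x => Quotient.liftOn' x (rsIntegrand hmn W W' s) hcompat := by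
      funext x
      rw [rsKernel, dif_pos hinv]
    -- continuity of the integrand `B(g) · |det g⁻¹|_F ^ (s - (n-m)/2)`
    have hpow : Continuous fun g : GL (Fin m) F =>
        ((((normAbs F ((Matrix.GeneralLinearGroup.det g⁻¹ : Fˣ) : F) : ℝ≥0) : ℝ) : ℂ)) ^
          (s - ((n : ℂ) - m) / 2) := by
      have hcomp : (fun g : GL (Fin m) F =>
          ((((normAbs F ((Matrix.GeneralLinearGroup.det g⁻¹ : Fˣ) : F) : ℝ≥0) : ℝ) : ℂ)) ^
            (s - ((n : ℂ) - m) / 2)) =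
          (fun a : ℝ => (a : ℂ) ^ (s - ((n : ℂ) - m) / 2)) ∘ fun g : GL (Fin m) F =>
            ((normAbs F ((Matrix.GeneralLinearGroup.det g⁻¹ : Fˣ) : F) : ℝ≥0) : ℝ) := rfl
      rw [hcomp]
      refine continuous_iff_continuousAt.2 fun g => ContinuousAt.comp ?_
        continuous_rsDetWeight.continuousAt
      exact Complex.continuousAt_ofReal_cpow_const _ _ (Or.inr (rsDetWeight_pos g).ne')
    have hcontI : Continuous (rsIntegrand hmn W W' s) := by
      have : rsIntegrand hmn W W' s = fun g => (W (glCorner F hmn.le g⁻¹) * W' g⁻¹) *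
          ((((normAbs F ((Matrix.GeneralLinearGroup.det g⁻¹ : Fˣ) : F) : ℝ≥0) : ℝ) : ℂ)) ^
            (s - ((n : ℂ) - m) / 2) := rfl
      rw [this]
      exact (hW.mul hW').mul hpow
    -- support of the integrand = support of `B`
    have hsuppI : Function.support (rsIntegrand hmn W W' s) ⊆
        C * (upperUnitriangular (Fin m) F : Set (GL (Fin m) F)) := by
      refine Set.Subset.trans (fun g hg => ?_) hsuppC
      rw [Function.mem_support] at hg ⊢
      intro h0
      apply hg
      show (W (glCorner F hmn.le g⁻¹) * W' g⁻¹) *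
          ((((normAbs F ((Matrix.GeneralLinearGroup.det g⁻¹ : Fˣ) : F) : ℝ≥0) : ℝ) : ℂ)) ^
            (s - ((n : ℂ) - m) / 2) = 0
      rw [h0, zero_mul]
    haveI : IsClosed (upperUnitriangular (Fin m) F : Set (GL (Fin m) F)) := by
      haveI : T2Space F :=
        (Literature.NumberTheory.GaloisRepresentations.IsNonarchimedeanLocalField.isLocalField F).toT2Space
      exact isClosed_upperUnitriangular
    rw [heq]
    exact ⟨hcontI.quotient_liftOn' _,
      hasCompactSupport_quotientLiftOn_of_support_subset _ hcompat hC hsuppI⟩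
  · have heq : rsKernel hmn W W' s = fun _ => 0 := by
      funext x
      rw [rsKernel, dif_neg hinv]
    rw [heq]
    exact ⟨continuous_const, HasCompactSupport.zero⟩

end Summit.Langlands.Langlands.Theorems

end
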